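import Literature.NumberTheory.EllipticCurves.Szpiro
import Literature.NumberTheory.EllipticCurves.GlobalMinimalModelProofs
import Literature.NumberTheory.DiophantineGeometry.MinimalDiscriminantNormProofs
import Literature.NumberTheory.DiophantineGeometry.MinimalDiscriminantSmulProofs
import Literature.NumberTheory.DiophantineGeometry.TateAlgorithmInvarianceProofs
import HarnessLib

/-!
# The modified Szpiro conjecture: what is provable around an open conjecture

Companion proof file of `Literature.NumberTheory.EllipticCurves.Szpiro` (theorems only; the named
facts stay in `Szpiro.lean`). Fact under tenure: `Literature.NumberTheory.EllipticCurves.ModifiedSzpiroConjecture`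
(`[cite: Oesterle1988, §3]`).

## Source reading (Oesterlé, *Nouvelles approches du «théorème» de Fermat*, Sém. Bourbaki 694,
Astérisque 161–162 (1988), 165–186; Numdam `SB_1987-1988__30__165_0`)

* §3, p. 169, **Conjecture 3** (abc, Masser–Oesterlé 1985): for every `ε > 0` there is `C(ε) > 0`
  with (14) `sup(|a|, |b|, |c|) ≤ C(ε) (rad abc)^{1+ε}` for all nonzero coprime `a + b + c = 0`.
* §3, p. 169, **Conjecture 4** (the *modified Szpiro conjecture*): "Pour tout `ε > 0`, il existe
  `C(ε) > 0` possédant la propriété suivante : pour toute courbe elliptique `E` sur `ℚ`, les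
  invariants `c₄` et `c₆` associés à un modèle minimal de `E` (cf. [Ta]) et le conducteur `N` de `E`
  vérifient (16) `sup(|c₄|³, |c₆|²) ≤ C(ε) N^{6+ε}`." This is `Literature.NumberTheory.EllipticCurves.ModifiedSzpiroConjecture`
  verbatim (global minimal model over `ℤ`, conductor `N_E`, the `sup` computed in `ℤ`); the vendored
  statement is faithful. **Conjecture 4'**: the same for semi-stable `E` only.
* §3, pp. 169–170: "Démontrons que la conjecture 3 équivaut aux deux conjectures suivantes" —
  Conj. 4 ⟹ Conj. 4' (clear) ⟹ Conj. 3 (Frey curve of `(a, b, c)`, as in Prop. 1) ⟹ Conj. 4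
  (after Hindry: apply (14) to `(c₄³/d, −c₆²/d, −1728Δ/d)`, `d = gcd(c₄³, c₆², 1728Δ)`, and bound
  `d · rad(1728 Δ c₄³ c₆² / d³) ∣ 6 c₄ c₆ N` place by place).
* §3, p. 169, remark: "la conjecture 4 implique la conjecture 2 [§2, p. 168: Szpiro's conjecture,
  strong form, `|Δ_E| ≤ C(ε) N_E^{6+ε}` for semi-stable `E / ℚ`], même sans y supposer `E`
  semi-stable, en vertu de l'égalité `1728 Δ_E = c₄³ − c₆²`" — i.e. Conjecture 4 implies
  `SzpiroConjecture` (all `E / ℚ`, Silverman AEC Conj. VIII.11.1).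

**Status.** `ModifiedSzpiroConjecture` is therefore equivalent to the abc conjecture (the summit
`ABC`), an open problem: no `ModifiedSzpiroConjecture_holds` can be asserted (CONVENTIONS: open
problems are `def … : Prop` only). This file proves what the source prints *around* it and what is
elementary:

* `Literature.NumberTheory.EllipticCurves.max_abs_Δ_c₄_le`, `Literature.NumberTheory.EllipticCurves.max_abs_c₄_c₆_le`: the two printed left-hand sides
  `max(|Δ|, |c₄|³)` (Bombieri–Gubler Conj. 12.5.11) and `max(|c₄|³, |c₆|²)` (Oesterlé Conj. 4) agree
  up to the factors `2` and `1729`, from `1728 Δ = c₄³ − c₆²` (Mathlib `WeierstrassCurve.c_relation`);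
* `Literature.NumberTheory.EllipticCurves.generalizedSzpiroBG_iff_modifiedSzpiro`:
  `GeneralizedSzpiroConjectureBG ↔ ModifiedSzpiroConjecture` (the glue named in the docstring of
  `abcLe_iff_generalizedSzpiroBG`);
* `Literature.NumberTheory.EllipticCurves.abcLe_iff_modifiedSzpiro`: Oesterlé's "Conjecture 3 ⟺ Conjecture 4", from the printed
  theorem of Bombieri–Gubler (Thm. 12.5.12, the named fact `abcLe_iff_generalizedSzpiroBG`, taken as
  hypothesis) and the previous item;
* `Literature.Abc.szpiro_of_modifiedSzpiro : ModifiedSzpiroConjecture → SzpiroConjecture`, Oesterlé's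
  remark "Conjecture 4 ⟹ Conjecture 2, même sans y supposer `E` semi-stable" (p. 169), proved
  unconditionally (an implication between two open conjectures): pass to a global minimal model over
  `ℤ` (`Literature.NumberTheory.EllipticCurves.exists_variableChange_eq_baseChange_int`, from
  `WeierstrassCurve.exists_variableChange_forall_isMinimalAt` with `R = ℤ` and
  `Literature.NumberTheory.EllipticCurves.isIntegral_int_of_forall_isMinimalAt`), use that the conductor and the minimal
  discriminant are isomorphism invariants (`WeierstrassCurve.conductor_smul` fed with the discharged
  facts `ordMinimalDiscriminant_smul_holds`, `kodairaSymbol_smul_holds`; this is what the imports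
  `MinimalDiscriminantSmulProofs`, `TateAlgorithmInvarianceProofs` are for), that
  `|Δ_min| = |Δ(W₀)|` on a global minimal model (`minimalDiscriminantNorm_eq_natAbs_holds`, import
  `MinimalDiscriminantNormProofs`), and `|Δ| ≤ 2 max(|c₄|³, |c₆|²)`.

## References

* J. Oesterlé, *Nouvelles approches du «théorème» de Fermat*, Sém. Bourbaki 694, Astérisque
  161–162 (1988), 165–186, §3 (Conj. 3, Conj. 4, (14), (16), pp. 169–170).
* E. Bombieri, W. Gubler, *Heights in Diophantine Geometry* (2006), Conj. 12.5.11, Thm. 12.5.12,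
  pp. 431–432.
* J. H. Silverman, *The Arithmetic of Elliptic Curves*, 2nd ed. (2009), VIII.8 (Prop. 8.2,
  Cor. 8.3: global minimal models over `ℤ`), VIII.11 (Conj. 11.1).
-/

open UniqueFactorizationMonoid IsDedekindDomain

namespace Literature.NumberTheory.EllipticCurves

/-- For any Weierstrass equation over `ℤ`, `max(|Δ|, |c₄|³) ≤ 2 · max(|c₄|³, |c₆|²)`, from
`1728 Δ = c₄³ − c₆²` (`WeierstrassCurve.c_relation`): `|Δ| ≤ 1728 |Δ| ≤ |c₄|³ + |c₆|²`. [folklore] -/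
theorem max_abs_Δ_c₄_le (W₀ : WeierstrassCurve ℤ) :
    max |W₀.Δ| (|W₀.c₄| ^ 3) ≤ 2 * max (|W₀.c₄| ^ 3) (|W₀.c₆| ^ 2) := by
  have hrel := W₀.c_relation
  have h4 : |W₀.c₄| ^ 3 ≤ max (|W₀.c₄| ^ 3) (|W₀.c₆| ^ 2) := le_max_left _ _
  have h6 : |W₀.c₆| ^ 2 ≤ max (|W₀.c₄| ^ 3) (|W₀.c₆| ^ 2) := le_max_right _ _
  have hM : 0 ≤ max (|W₀.c₄| ^ 3) (|W₀.c₆| ^ 2) := le_trans (by positivity) h4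
  refine max_le ?_ (by linarith)
  have hΔ : |W₀.Δ| ≤ 1728 * |W₀.Δ| := le_mul_of_one_le_left (abs_nonneg _) (by norm_num)
  calc |W₀.Δ| ≤ 1728 * |W₀.Δ| := hΔ
    _ = |W₀.c₄ ^ 3 - W₀.c₆ ^ 2| := by
        rw [← hrel, abs_mul]; norm_num
    _ ≤ |W₀.c₄ ^ 3| + |W₀.c₆ ^ 2| := abs_sub _ _
    _ = |W₀.c₄| ^ 3 + |W₀.c₆| ^ 2 := by rw [abs_pow, abs_pow]
    _ ≤ 2 * max (|W₀.c₄| ^ 3) (|W₀.c₆| ^ 2) := by linarith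

/-- For any Weierstrass equation over `ℤ`, `max(|c₄|³, |c₆|²) ≤ 1729 · max(|Δ|, |c₄|³)`, from
`c₆² = c₄³ − 1728 Δ` (`WeierstrassCurve.c_relation`). The factor `1729` is the one named in the
docstring of `GeneralizedSzpiroConjectureBG`. [folklore] -/
theorem max_abs_c₄_c₆_le (W₀ : WeierstrassCurve ℤ) :
    max (|W₀.c₄| ^ 3) (|W₀.c₆| ^ 2) ≤ 1729 * max |W₀.Δ| (|W₀.c₄| ^ 3) := by
  have hrel := W₀.c_relation
  have hD : |W₀.Δ| ≤ max |W₀.Δ| (|W₀.c₄| ^ 3) := le_max_left _ _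
  have h4 : |W₀.c₄| ^ 3 ≤ max |W₀.Δ| (|W₀.c₄| ^ 3) := le_max_right _ _
  have hM : 0 ≤ max |W₀.Δ| (|W₀.c₄| ^ 3) := le_trans (abs_nonneg _) hD
  refine max_le (by linarith) ?_
  calc |W₀.c₆| ^ 2 = |W₀.c₆ ^ 2| := (abs_pow _ _).symm
    _ = |W₀.c₄ ^ 3 - 1728 * W₀.Δ| := by rw [hrel]; ring_nf
    _ ≤ |W₀.c₄ ^ 3| + |1728 * W₀.Δ| := abs_sub _ _
    _ = |W₀.c₄| ^ 3 + 1728 * |W₀.Δ| := by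
        rw [abs_pow, abs_mul]; norm_num
    _ ≤ 1729 * max |W₀.Δ| (|W₀.c₄| ^ 3) := by linarith

/-- **abc.S10** The generalized Szpiro conjecture as printed by Bombieri–Gubler (Conj. 12.5.11,
`max(|Δ|, |c₄|³) ≪_ε N^{6+ε}`, `GeneralizedSzpiroConjectureBG`) is equivalent to the modified Szpiro
conjecture as printed by Oesterlé (Sém. Bourbaki 694 (1988), §3, Conj. 4, (16):
`sup(|c₄|³, |c₆|²) ≤ C(ε) N^{6+ε}`, `ModifiedSzpiroConjecture`): both quantify over global minimal
models over `ℤ`, and the two left-hand sides agree up to the factors `2` and `1729`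
(`max_abs_Δ_c₄_le`, `max_abs_c₄_c₆_le`), which the constant absorbs. This is the glue
"`GeneralizedSzpiroConjectureBG ⟺ ModifiedSzpiroConjecture` via `c_relation`" named in the docstring
of `abcLe_iff_generalizedSzpiroBG`. [folklore] -/
theorem generalizedSzpiroBG_iff_modifiedSzpiro :
    GeneralizedSzpiroConjectureBG ↔ ModifiedSzpiroConjecture := by
  constructor
  · intro h ε hε
    obtain ⟨C, hC⟩ := h ε hε
    refine ⟨1729 * max C 0, fun W₀ hE hmin => ?_⟩
    have hpow : (0 : ℝ) ≤ ((W₀.baseChange ℚ).conductorNorm ℤ : ℝ) ^ (6 + ε) :=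
      Real.rpow_nonneg (Nat.cast_nonneg _) _
    have h1 : ((max (|W₀.c₄| ^ 3) (|W₀.c₆| ^ 2) : ℤ) : ℝ) ≤
        ((1729 * max |W₀.Δ| (|W₀.c₄| ^ 3) : ℤ) : ℝ) := by
      exact_mod_cast max_abs_c₄_c₆_le W₀
    have h2 := hC W₀ hE hmin
    rw [Int.cast_mul] at h1
    calc ((max (|W₀.c₄| ^ 3) (|W₀.c₆| ^ 2) : ℤ) : ℝ)
        ≤ ((1729 : ℤ) : ℝ) * ((max |W₀.Δ| (|W₀.c₄| ^ 3) : ℤ) : ℝ) := h1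
      _ ≤ ((1729 : ℤ) : ℝ) * (C * ((W₀.baseChange ℚ).conductorNorm ℤ : ℝ) ^ (6 + ε)) := by
          gcongr
      _ ≤ ((1729 : ℤ) : ℝ) * (max C 0 * ((W₀.baseChange ℚ).conductorNorm ℤ : ℝ) ^ (6 + ε)) := by
          gcongr
          exact le_max_left _ _
      _ = 1729 * max C 0 * ((W₀.baseChange ℚ).conductorNorm ℤ : ℝ) ^ (6 + ε) := by
          push_cast; ring
  · intro h ε hε
    obtain ⟨C, hC⟩ := h ε hε
    refine ⟨2 * max C 0, fun W₀ hE hmin => ?_⟩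
    have hpow : (0 : ℝ) ≤ ((W₀.baseChange ℚ).conductorNorm ℤ : ℝ) ^ (6 + ε) :=
      Real.rpow_nonneg (Nat.cast_nonneg _) _
    have h1 : ((max |W₀.Δ| (|W₀.c₄| ^ 3) : ℤ) : ℝ) ≤
        ((2 * max (|W₀.c₄| ^ 3) (|W₀.c₆| ^ 2) : ℤ) : ℝ) := by
      exact_mod_cast max_abs_Δ_c₄_le W₀
    have h2 := hC W₀ hE hmin
    rw [Int.cast_mul] at h1
    calc ((max |W₀.Δ| (|W₀.c₄| ^ 3) : ℤ) : ℝ)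
        ≤ ((2 : ℤ) : ℝ) * ((max (|W₀.c₄| ^ 3) (|W₀.c₆| ^ 2) : ℤ) : ℝ) := h1
      _ ≤ ((2 : ℤ) : ℝ) * (C * ((W₀.baseChange ℚ).conductorNorm ℤ : ℝ) ^ (6 + ε)) := by
          gcongr
      _ ≤ ((2 : ℤ) : ℝ) * (max C 0 * ((W₀.baseChange ℚ).conductorNorm ℤ : ℝ) ^ (6 + ε)) := by
          gcongr
          exact le_max_left _ _
      _ = 2 * max C 0 * ((W₀.baseChange ℚ).conductorNorm ℤ : ℝ) ^ (6 + ε) := by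
          push_cast; ring

/-- **abc.S10** (Oesterlé, Sém. Bourbaki 694 (1988), §3, pp. 169–170: "Démontrons que la conjecture 3
équivaut aux deux conjectures suivantes sur les courbes elliptiques : Conjecture 4 […] Conjecture 4'",
with the proof Conj. 4 ⟹ 4' ⟹ 3 ⟹ 4 printed there). The abc conjecture — here the `≤`-sentence of
Bombieri–Gubler Conj. 12.2.2 over `IsABCTriple`/`rad`, which the audit of
`Summits/ABC/ABC/Statement.lean` certifies equivalent to `ABC` — is equivalent to the modified
Szpiro conjecture `ModifiedSzpiroConjecture` (Oesterlé's Conjecture 4). Proved here from the printed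
theorem of Bombieri–Gubler (Thm. 12.5.12 (a) ⟺ (c), the named fact `abcLe_iff_generalizedSzpiroBG`,
hypothesis `h`) composed with `generalizedSzpiroBG_iff_modifiedSzpiro`. In particular
`ModifiedSzpiroConjecture` is exactly as open as the abc conjecture. [cite: Oesterle1988, §3 Conj. 3 ⟺ Conj. 4, pp. 169–170] -/
theorem abcLe_iff_modifiedSzpiro (h : abcLe_iff_generalizedSzpiroBG) :
    (∀ ε : ℝ, 0 < ε → ∃ C : ℝ, ∀ a b c : ℕ, DiophantineGeometry.IsABCTriple a b c →
        (c : ℝ) ≤ C * ((DiophantineGeometry.rad a b c : ℕ) : ℝ) ^ (1 + ε)) ↔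
      ModifiedSzpiroConjecture :=
  h.trans generalizedSzpiroBG_iff_modifiedSzpiro

/-! ### Oesterlé's remark: Conjecture 4 ⟹ Conjecture 2 (modified Szpiro ⟹ Szpiro) -/

/-- A Weierstrass equation over `ℚ` which is minimal (hence integral) at every prime has
coefficients in `ℤ`: integrality over the Dedekind domain `ℤ` is a local condition
(Mathlib `IsDedekindDomain.HeightOneSpectrum.mem_integers_of_valuation_le_one`). The `𝓞 K`-version
is `WeierstrassCurve.isIntegral_ringOfIntegers_of_forall_isMinimalAt`; this is the same proof over
`ℤ`. Silverman, AEC VIII.8 (definition preceding Prop. 8.2). [folklore] -/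
theorem isIntegral_int_of_forall_isMinimalAt (W : WeierstrassCurve ℚ)
    (h : ∀ v : HeightOneSpectrum ℤ, W.IsMinimalAt v) : W.IsIntegral ℤ := by
  have key : ∀ x : ℚ, (∀ v : HeightOneSpectrum ℤ,
      algebraMap ℚ (v.adicCompletion ℚ) x ∈
        (algebraMap (v.adicCompletionIntegers ℚ) (v.adicCompletion ℚ)).range) →
      ∃ r : ℤ, algebraMap ℤ ℚ r = x := by
    intro x hx
    exact HeightOneSpectrum.mem_integers_of_valuation_le_one (R := ℤ) ℚ x fun v => by
      rw [← HeightOneSpectrum.valued_algebraMap]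
      exact (WeierstrassCurve.algebraMap_adicCompletionIntegers_range_iff v _).mp (hx v)
  have hI := fun v : HeightOneSpectrum ℤ =>
    haveI : (W.baseChange (v.adicCompletion ℚ)).IsMinimal (v.adicCompletionIntegers ℚ) := h v
    WeierstrassCurve.IsIntegral.a_mem_range (R := v.adicCompletionIntegers ℚ)
      (W.baseChange (v.adicCompletion ℚ))
  apply WeierstrassCurve.isIntegral_of_exists_lift
  · exact key _ fun v => by simpa [WeierstrassCurve.baseChange] using (hI v).1
  · exact key _ fun v => by simpa [WeierstrassCurve.baseChange] using (hI v).2.1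
  · exact key _ fun v => by simpa [WeierstrassCurve.baseChange] using (hI v).2.2.1
  · exact key _ fun v => by simpa [WeierstrassCurve.baseChange] using (hI v).2.2.2.1
  · exact key _ fun v => by simpa [WeierstrassCurve.baseChange] using (hI v).2.2.2.2

/-- Every elliptic Weierstrass equation over `ℚ` is `ℚ`-isomorphic to the base change of a global
minimal Weierstrass equation over `ℤ` (integral coefficients, minimal at every prime), in the
`HeightOneSpectrum ℤ` conventions of `ModifiedSzpiroConjecture`. Néron 1964; Silverman, AEC
VIII.8, Prop. 8.2 and Cor. 8.3 (`ℤ` is a principal ideal domain); assembled from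
`WeierstrassCurve.exists_variableChange_forall_isMinimalAt` (with `R = ℤ`) and
`isIntegral_int_of_forall_isMinimalAt`. [cite: SilvermanAEC2009, VIII.8 Cor. 8.3] -/
theorem exists_variableChange_eq_baseChange_int (W : WeierstrassCurve ℚ) [W.IsElliptic] :
    ∃ (D : WeierstrassCurve.VariableChange ℚ) (W₀ : WeierstrassCurve ℤ),
      D • W = W₀.baseChange ℚ ∧ ∀ v : HeightOneSpectrum ℤ, (W₀.baseChange ℚ).IsMinimalAt v := by
  obtain ⟨D, hD⟩ := WeierstrassCurve.exists_variableChange_forall_isMinimalAt (R := ℤ)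
    (WeierstrassCurve.finite_setOf_not_isMinimalAt (R := ℤ) W W.isUnit_Δ.ne_zero).toFinset W
    (by simp)
  obtain ⟨W₀, hW₀⟩ := (isIntegral_int_of_forall_isMinimalAt (D • W) hD).integral
  exact ⟨D, W₀, hW₀, fun v => hW₀ ▸ hD v⟩

/-- **abc.S10** (Oesterlé, Sém. Bourbaki 694 (1988), §3, p. 169, remark after Conjecture 4':
"On notera que la conjecture 4 implique la conjecture 2, même sans y supposer `E` semi-stable, en
vertu de l'égalité `1728 Δ_E = c₄³ − c₆²`.") The modified Szpiro conjecture implies Szpiro's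
conjecture `|Δ_min(E)| ≤ C(ε) N_E^{6+ε}` for *all* elliptic curves `E / ℚ` (`SzpiroConjecture`),
with `C ↦ 2 · max(C, 0)`. Proof as printed: pass to a global minimal model `W₀` over `ℤ`
(`exists_variableChange_eq_baseChange_int`); the conductor and the minimal discriminant are
isomorphism invariants (`WeierstrassCurve.conductor_smul` with `ordMinimalDiscriminant_smul_holds`,
`kodairaSymbol_smul_holds`), `|Δ_min| = |Δ(W₀)|` (`minimalDiscriminantNorm_eq_natAbs_holds`), and
`|Δ(W₀)| ≤ 2 max(|c₄|³, |c₆|²)` (`max_abs_Δ_c₄_le`). An implication between two open conjectures;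
neither side is asserted. [cite: Oesterle1988, §3 p. 169 (remark after Conj. 4')] -/
theorem szpiro_of_modifiedSzpiro : ModifiedSzpiroConjecture → SzpiroConjecture := by
  intro h ε hε
  obtain ⟨C, hC⟩ := h ε hε
  refine ⟨2 * max C 0, ?_⟩
  intro W _
  obtain ⟨D, W₀, hW₀, hmin⟩ := exists_variableChange_eq_baseChange_int W
  have hE : (W₀.baseChange ℚ).IsElliptic := hW₀ ▸ inferInstance
  have hΔ₀ : W₀.Δ ≠ 0 := by
    intro h0
    haveI := hE
    apply (W₀.baseChange ℚ).isUnit_Δ.ne_zero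
    rw [WeierstrassCurve.baseChange, WeierstrassCurve.map_Δ, h0, map_zero]
  -- the conductor is an isomorphism invariant
  have hN : (W₀.baseChange ℚ).conductorNorm ℤ = W.conductorNorm ℤ := by
    rw [← hW₀, WeierstrassCurve.conductorNorm, WeierstrassCurve.conductorNorm,
      WeierstrassCurve.conductor_smul ℤ W (fun v => WeierstrassCurve.ordMinimalDiscriminant_smul_holds v W)
        (fun v => WeierstrassCurve.kodairaSymbol_smul_holds (v.adicCompletionIntegers ℚ)) D]
  -- the minimal discriminant is an isomorphism invariant, and equals `|Δ(W₀)|` on the minimal model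
  have hdisc : W.minimalDiscriminantNorm ℤ = W₀.Δ.natAbs := by
    have h1 : (D • W).minimalDiscriminantNorm ℤ = W.minimalDiscriminantNorm ℤ := by
      simp only [WeierstrassCurve.minimalDiscriminantNorm, WeierstrassCurve.minimalDiscriminantIdeal,
        WeierstrassCurve.ordMinimalDiscriminant_smul_holds _ W D]
    rw [← h1, hW₀]
    exact WeierstrassCurve.minimalDiscriminantNorm_eq_natAbs_holds W₀ hΔ₀ hmin
  have key := hC W₀ hE hmin
  rw [hN] at key
  rw [hdisc, Nat.cast_natAbs]
  have hpow : (0 : ℝ) ≤ (W.conductorNorm ℤ : ℝ) ^ (6 + ε) := Real.rpow_nonneg (Nat.cast_nonneg _) _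
  have h2 : ((|W₀.Δ| : ℤ) : ℝ) ≤ ((2 * max (|W₀.c₄| ^ 3) (|W₀.c₆| ^ 2) : ℤ) : ℝ) := by
    exact_mod_cast (le_max_left _ _).trans (max_abs_Δ_c₄_le W₀)
  rw [Int.cast_mul] at h2
  calc ((|W₀.Δ| : ℤ) : ℝ)
      ≤ ((2 : ℤ) : ℝ) * ((max (|W₀.c₄| ^ 3) (|W₀.c₆| ^ 2) : ℤ) : ℝ) := h2
    _ ≤ ((2 : ℤ) : ℝ) * (C * (W.conductorNorm ℤ : ℝ) ^ (6 + ε)) := by gcongr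
    _ ≤ ((2 : ℤ) : ℝ) * (max C 0 * (W.conductorNorm ℤ : ℝ) ^ (6 + ε)) := by
        gcongr
        exact le_max_left _ _
    _ = 2 * max C 0 * (W.conductorNorm ℤ : ℝ) ^ (6 + ε) := by push_cast; ring

end Literature.NumberTheory.EllipticCurves
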